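import Mathlib.AlgebraicGeometry.Noetherian
import Literature.AlgebraicGeometry.Motives.AtypicalHodgeLocus
import Literature.AlgebraicGeometry.Motives.PeriodRealizationClassical
import Literature.AlgebraicGeometry.Motives.FamiliesVHS
import HarnessLib

/-!
# Crux `QbarGenericIsHodgeGeneric` (stmt-HodgeConjecture-11595), line `birth`: the bookkeeping half of
# stub (iv') — special subvarieties meeting an affine open are countable GIVEN a rank envelope

Helper file (`--supports stmt-HodgeConjecture-11595`) of the line lead c1 (proofs by the wave-1
stub-worker of (iv')). Stub (iv') `stub_countable_special_meeting_affineOpen` of the skeleton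
`Cruxes/QbarGenericIsHodgeGeneric/Lines/birth.lean` is verbatim the named Literature fact
`Literature.AlgebraicGeometry.Motives.countable_specialSubvarieties_meeting_affineOpen`
(Cattani–Deligne–Kaplan 1995 Thm. 1.1 / Cor. 1.2 in the form of Baldi–Klingler–Ullmo 2024 §3.4,
Def. 3.3, Lemma 3.6; André 1992 §5), an unproved `def … : Prop` of the tree (p154148): nothing in
the tree discharges it (no holomorphic period map, no CDK, no irreducible components of Hodge loci).
This file isolates and PROVES the part of a future discharge that is pure topology / order theory on
the tree's carriers, so that the named fact is reduced to exactly the Hodge-theoretic input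
(a countable RANK ENVELOPE: countably many Zariski-closed sets, each special `Y` meeting the chart
inside one of them without increase of generic Mumford–Tate rank — what CDK 1995 + André 1992 §5
deliver for the Gauss–Manin variation): `countable_special_meeting_affineOpen_of_rankEnvelope`.

This file proves the ONE item of the discharge's dependency list that is in reach today:
**a Zariski-closed set of complex points has only finitely many irreducible components meeting a
given affine open** of a smooth (hence locally Noetherian) `ℂ`-scheme — the step "each algebraic
preimage `Φ⁻¹(Γ_{G'} \ D')` contributes finitely many special subvarieties" of BKU §3.4, on the
tree's carriers `ZariskiPoints` / `IsIrredComponentOnPoints` (`Motives/AtypicalHodgeLocus`).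

* `finite_maximal_irreducible_closed_meeting` — pure topology: in any space, the closed irreducible
  subsets of a closed `A` maximal in `A` and meeting an open `V` with `V` Noetherian are finitely
  many (they are closures of images of the finitely many irreducible closed pieces of `A ∩ V`).
* `finite_irredComponentsOnPoints_meeting_affineOpen` — for `S` smooth over `ℂ`, `U ⊆ S` an affine
  open and `A ⊆ S(ℂ)` Zariski closed on points, `{Y | IsIrredComponentOnPoints S A Y ∧ Y meets U(ℂ)}`
  is finite; `countable_irredComponentsOnPoints_meeting_affineOpen` — countable version over a
  countable family of closed sets.
* `countable_special_meeting_affineOpen_of_envelope` — the bookkeeping reduction: the stub follows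
  as soon as the special subvarieties meeting `U` are enveloped by countably many Zariski-closed sets
  (each special `Y` an irreducible component of one of them) — which is exactly what CDK 1995 +
  André 1992 §5 deliver for the Gauss–Manin variation and what the tree cannot yet state-and-prove
  (no holomorphic variation of the Hodge filtration as a theorem, no period map, no CDK).
* `genericMTRank_mono`, `isIrredComponentOnPoints_of_isSpecialSubvariety` (order-theoretic core of
  BKU Lemma 3.6: special `Y ⊆ A` closed with no rank increase ⟹ `Y` is a component of `A`) and
  `countable_special_meeting_affineOpen_of_rankEnvelope` — the stub from the exact CDK + André
  interface: countably many closed `A`'s, each special `Y` meeting `U` inside one without rank increase.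
-/

noncomputable section

-- every declaration of this problem lives in `Summit.HodgeConjecture.HodgeConjecture.…` (problem = summit)
set_option linter.dupNamespace false

open CategoryTheory AlgebraicGeometry Literature.AlgebraicGeometry.Motives
open _root_.Topology TopologicalSpace

namespace Summit.HodgeConjecture.HodgeConjecture.Theorems

/-- **Finitely many maximal irreducible closed subsets of a closed set meet a Noetherian open.**
In a topological space `X`, let `A` be closed and `V` open with `V` a Noetherian subspace. Then the
closed irreducible `Y ⊆ A`, maximal among the closed irreducible subsets of `A`, with `Y ∩ V ≠ ∅`,
form a finite set: `A ∩ V` is a finite union of irreducible closed pieces `s` (Noetherian), `Y` is the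
closure of `Y ∩ V`, which lies in the finite union of the closed irreducible sets `closure s ⊆ A`,
hence in one of them, hence equals it by maximality. [folklore] -/
theorem finite_maximal_irreducible_closed_meeting {X : Type*} [TopologicalSpace X] {A V : Set X}
    (hA : IsClosed A) (hV : IsOpen V) [NoetherianSpace V] :
    {Y : Set X | IsClosed Y ∧ IsIrreducible Y ∧ Y ⊆ A ∧
      (∀ Y' : Set X, IsClosed Y' → IsIrreducible Y' → Y ⊆ Y' → Y' ⊆ A → Y' = Y) ∧
      (Y ∩ V).Nonempty}.Finite := by
  classical
  -- the trace of `A` on the Noetherian subspace `V` is a finite union of irreducible closed pieces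
  have hB : IsClosed ((Subtype.val : V → X) ⁻¹' A) := hA.preimage continuous_subtype_val
  obtain ⟨𝒮, h𝒮f, -, h𝒮i, hB𝒮⟩ := NoetherianSpace.exists_finite_set_isClosed_irreducible hB
  -- candidate components: closures of the images of the pieces (a finite set `T`)
  set T : Finset (Set X) := (h𝒮f.image fun s : Set V => closure (Subtype.val '' s)).toFinset
    with hTdef
  have hTmem : ∀ t, t ∈ T ↔ ∃ s ∈ 𝒮, closure (Subtype.val '' s) = t := fun t => by
    simp [hTdef]
  have hTc : ∀ t ∈ T, IsClosed t := fun t ht => by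
    obtain ⟨s, -, rfl⟩ := (hTmem t).1 ht
    exact isClosed_closure
  refine (T.finite_toSet).subset ?_
  rintro Y ⟨hYc, hYi, hYA, hYmax, hYV⟩
  -- `Y` is the closure of its trace on `V`, which lies in the union of the candidates
  have hYcl : Y ⊆ closure (Y ∩ V) := subset_closure_inter_of_isPreirreducible_of_isOpen hYi.2 hV hYV
  have hUc : IsClosed (⋃₀ (↑T : Set (Set X))) := by
    rw [Set.sUnion_eq_biUnion]
    exact T.finite_toSet.isClosed_biUnion fun t ht => hTc t ht
  have hcov : Y ⊆ ⋃₀ (↑T : Set (Set X)) := by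
    refine hYcl.trans (closure_minimal ?_ hUc)
    rintro x ⟨hxY, hxV⟩
    have hxB : (⟨x, hxV⟩ : V) ∈ (Subtype.val : V → X) ⁻¹' A := hYA hxY
    rw [hB𝒮] at hxB
    obtain ⟨s, hs, hxs⟩ := Set.mem_sUnion.1 hxB
    exact Set.mem_sUnion.2 ⟨closure (Subtype.val '' s), (hTmem _).2 ⟨s, hs, rfl⟩,
      subset_closure ⟨⟨x, hxV⟩, hxs, rfl⟩⟩
  -- an irreducible set inside a finite union of closed sets lies in one of them
  obtain ⟨Z, hZ, hYZ⟩ := isIrreducible_iff_sUnion_isClosed.1 hYi T hTc hcov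
  obtain ⟨s, hs, rfl⟩ := (hTmem Z).1 hZ
  -- and by maximality equals it
  refine (hYmax _ isClosed_closure ?_ hYZ (closure_minimal ?_ hA)) ▸ hZ
  · exact ((h𝒮i s hs).image _ continuous_subtype_val.continuousOn).closure
  · rintro _ ⟨y, hy, rfl⟩
    have : y ∈ (Subtype.val : V → X) ⁻¹' A := by rw [hB𝒮]; exact Set.mem_sUnion.2 ⟨s, hs, hy⟩
    exact this

/-- The image under `ZariskiPoints.val` recovers a set of points from its Zariski view:
`zariskiSet T (val '' Y') = Y'` (`val` is the identity of the synonym). [folklore] -/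
theorem zariskiSet_image_val {k : Type} [Field k] {T : SchemeOver k} {L : Type} [Field L]
    [Algebra k L] (Y' : Set (ZariskiPoints T L)) :
    zariskiSet T (ZariskiPoints.val '' Y') = Y' := by
  ext P
  simp only [mem_zariskiSet_iff, Set.mem_image]
  exact ⟨fun ⟨Q, hQ, hQP⟩ => (show Q = P from hQP) ▸ hQ, fun h => ⟨P, h, rfl⟩⟩

/-- `zariskiSet T` is injective (it is the preimage under the identity of the synonym). [folklore] -/
theorem zariskiSet_injective {k : Type} [Field k] (T : SchemeOver k) {L : Type} [Field L]
    [Algebra k L] : Function.Injective (zariskiSet T : Set (AlgPoints T L) → Set (ZariskiPoints T L)) :=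
  fun A B h => by
    ext P
    exact Iff.of_eq (congrArg (fun C : Set (ZariskiPoints T L) =>
      (show ZariskiPoints T L from P) ∈ C) h)

/-- **A Zariski-closed set of complex points has finitely many irreducible components meeting a
given affine open.** For `S` smooth over `ℂ` (hence locally of finite type, hence locally
Noetherian: Mathlib `LocallyOfFiniteType.isLocallyNoetherian`), `U ⊆ S` an affine open (so the
space `U` is Noetherian, Mathlib `noetherianSpace_of_isAffineOpen`) and `A ⊆ S(ℂ)` Zariski closed on
points, the irreducible components of `A` (`IsIrredComponentOnPoints`, on the Zariski topology of
`S(ℂ)` induced along `P ↦ P.pt`) containing a point of `U(ℂ)` form a finite set: the points over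
`U` form an open subspace of `ZariskiPoints S ℂ` whose topology is induced from the Noetherian `U`,
and `finite_maximal_irreducible_closed_meeting` applies. This is the step "each (algebraic, by
Cattani–Deligne–Kaplan) preimage of a special subvariety of `Γ \ D` has finitely many irreducible
components" of Baldi–Klingler–Ullmo 2024, §3.4, on the tree's carriers. [folklore] -/
theorem finite_irredComponentsOnPoints_meeting_affineOpen {S : SchemeOver ℂ}
    (hsm : AlgebraicGeometry.Smooth S.hom) (U : S.left.Opens) (hU : IsAffineOpen U)
    {A : Set (ComplexPoints S)} (hA : IsZariskiClosedOnPoints S A) :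
    {Y : Set (ComplexPoints S) | IsIrredComponentOnPoints S A Y ∧ ∃ y ∈ Y, y.pt ∈ U}.Finite := by
  -- `S` is locally Noetherian, so the affine open `U` is a Noetherian space
  haveI := hsm
  haveI : IsLocallyNoetherian S.left := LocallyOfFiniteType.isLocallyNoetherian S.hom
  haveI : IsNoetherianRing Γ(S.left, U) := IsLocallyNoetherian.component_noetherian ⟨U, hU⟩
  -- (Mathlib's lemma is about the SCHEME `↑U`; move it to the subspace `(U : Set S)` along `U.ι`)
  haveI hUsch : NoetherianSpace (U : Scheme) := noetherianSpace_of_isAffineOpen U hU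
  haveI : NoetherianSpace (U : Set S.left) := by
    have h := NoetherianSpace.range U.ι.base U.ι.base.hom.continuous
    rwa [Scheme.Opens.range_ι] at h
  -- the points over `U`: an open subspace `V` of `ZariskiPoints S ℂ`, induced from `U`, Noetherian
  set pt' : ZariskiPoints S ℂ → S.left := fun P => P.val.pt with hpt'
  have hind : IsInducing pt' := ⟨rfl⟩
  set V : Set (ZariskiPoints S ℂ) := pt' ⁻¹' (U : Set S.left) with hVdef
  have hV : IsOpen V := hind.continuous.isOpen_preimage _ U.isOpen
  haveI : NoetherianSpace V := by
    let g : V → U := fun P => ⟨pt' P.1, P.2⟩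
    have hg : IsInducing g := by
      rw [← IsInducing.subtypeVal.of_comp_iff]
      exact hind.comp IsInducing.subtypeVal
    exact hg.noetherianSpace
  -- the pure-topology finiteness on `ZariskiPoints S ℂ`, pulled back along the injective `zariskiSet S`
  have hAc : IsClosed (zariskiSet S A) := (isZariskiClosedOnPoints_iff_isClosed A).1 hA
  refine ((finite_maximal_irreducible_closed_meeting hAc hV).preimage
    (zariskiSet_injective S).injOn).subset ?_
  rintro Y ⟨⟨⟨hYc, hYi⟩, hYA, hYmax⟩, y, hy, hyU⟩
  refine ⟨hYc, hYi, Set.preimage_mono hYA, fun Y' hY'c hY'i hYY' hY'A => ?_,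
    ⟨(show ZariskiPoints S ℂ from y), hy, hyU⟩⟩
  -- maximality transfers: `Y' = zariskiSet S (val '' Y')`
  rw [← zariskiSet_image_val Y'] at hY'c hY'i hYY' hY'A ⊢
  rw [hYmax (ZariskiPoints.val '' Y') ⟨hY'c, hY'i⟩ (fun P hP => hYY' (show
    (show ZariskiPoints S ℂ from P) ∈ zariskiSet S Y from hP)) (fun P hP => hY'A (show
    (show ZariskiPoints S ℂ from P) ∈ zariskiSet S (ZariskiPoints.val '' Y') from hP))]

/-- **Countably many closed sets have countably many irreducible components meeting an affine
open** (countable union of the finite sets `finite_irredComponentsOnPoints_meeting_affineOpen`).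
[folklore] -/
theorem countable_irredComponentsOnPoints_meeting_affineOpen {S : SchemeOver ℂ}
    (hsm : AlgebraicGeometry.Smooth S.hom) (U : S.left.Opens) (hU : IsAffineOpen U)
    {𝒜 : Set (Set (ComplexPoints S))} (h𝒜c : 𝒜.Countable)
    (h𝒜z : ∀ A ∈ 𝒜, IsZariskiClosedOnPoints S A) :
    {Y : Set (ComplexPoints S) | (∃ A ∈ 𝒜, IsIrredComponentOnPoints S A Y) ∧
      ∃ y ∈ Y, y.pt ∈ U}.Countable := by
  refine (h𝒜c.biUnion fun A hA =>
    (finite_irredComponentsOnPoints_meeting_affineOpen hsm U hU (h𝒜z A hA)).countable).mono ?_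
  rintro Y ⟨⟨A, hA, hY⟩, hyU⟩
  exact Set.mem_biUnion hA ⟨hY, hyU⟩

/-- **Shape of the missing input (bookkeeping reduction of the stub).** If the special
subvarieties of `S` for `D` meeting the affine open `U` are ENVELOPED by countably many Zariski-closed
sets of points — every special `Y` meeting `U(ℂ)` is an irreducible component of some member of a
countable family `𝒜` — then they are countably many. For the honest Gauss–Manin datum the envelope
is supplied by Cattani–Deligne–Kaplan 1995 (Thm. 1.1 / Cor. 1.2, applied to the tensor
constructions of `Rⁱf_*ℤ` over `U`: the images in `U` of the countably many components of the loci
of Hodge tensors are closed algebraic) together with André 1992 §5 / Baldi–Klingler–Ullmo 2024 §3.2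
(`MT(V_z) ⊆ G` on such an image, generic Mumford–Tate groups attained on dense opens), cf. BKU
§3.4 and Lemma 3.6; that input is the named fact
`Literature.AlgebraicGeometry.Motives.countable_specialSubvarieties_meeting_affineOpen` minus the
present bookkeeping, and is NOT available in the tree. [cite: BaldiKlinglerUllmo2024, §3.4 and Lemma 3.6] -/
theorem countable_special_meeting_affineOpen_of_envelope [HodgeTensorFacts.{0, 0}]
    {B : BettiHodgeData ℂ} {𝒳 S : SchemeOver ℂ} {f : 𝒳 ⟶ S} {n i : ℕ}
    (D : GeometricVHSData B f n i) [∀ s, Module.Finite ℚ (D.V.fiber s)]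
    (hsm : AlgebraicGeometry.Smooth S.hom) (U : S.left.Opens) (hU : IsAffineOpen U)
    (henv : ∃ 𝒜 : Set (Set (ComplexPoints S)), 𝒜.Countable ∧ (∀ A ∈ 𝒜, IsZariskiClosedOnPoints S A) ∧
      ∀ Y : Set (ComplexPoints S), D.IsSpecialSubvariety Y → (∃ y ∈ Y, y.pt ∈ U) →
        ∃ A ∈ 𝒜, IsIrredComponentOnPoints S A Y) :
    {Y : Set (ComplexPoints S) | D.IsSpecialSubvariety Y ∧ ∃ y ∈ Y, y.pt ∈ U}.Countable := by
  obtain ⟨𝒜, h𝒜c, h𝒜z, h𝒜⟩ := henv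
  refine (countable_irredComponentsOnPoints_meeting_affineOpen hsm U hU h𝒜c h𝒜z).mono ?_
  rintro Y ⟨hY, hyU⟩
  exact ⟨h𝒜 Y hY hyU, hyU⟩

/-- **Monotonicity of the generic Mumford–Tate rank** (bounded ranks): `Y ⊆ Z`, `Y ≠ ∅` ⟹
`genericMTRank Y ≤ genericMTRank Z` (an `ℕ`-supremum over a larger set; BKU §3.2: `G_Y ⊆ G_Z`).
[cite: BaldiKlinglerUllmo2024, §3.2] -/
theorem genericMTRank_mono [HodgeTensorFacts.{0, 0}] {S' : Type} [TopologicalSpace S'] {w : ℤ}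
    (D : VHSData S' w) [∀ s, Module.Finite ℚ (D.V.fiber s)]
    (hbdd : BddAbove (Set.range fun s : S' => D.mtRankAt s)) {Y Z : Set S'} (hYZ : Y ⊆ Z)
    (hY : Y.Nonempty) : D.genericMTRank Y ≤ D.genericMTRank Z := by
  haveI : Nonempty Y := hY.to_subtype
  have hbZ : BddAbove (Set.range fun z : Z => D.mtRankAt z) := by
    obtain ⟨M, hM⟩ := hbdd
    exact ⟨M, by rintro _ ⟨z, rfl⟩; exact hM ⟨z, rfl⟩⟩
  exact ciSup_le fun y => D.mtRankAt_le_genericMTRank hbZ (hYZ y.2)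

/-- **Order-theoretic core of BKU Lemma 3.6: a special subvariety is an irreducible component of any
closed set containing it without rank increase.** If `Y` is special for `D`, `A ⊇ Y` is Zariski closed
on points and `genericMTRank A ≤ genericMTRank Y` (e.g. `MT(V_a) ⊆ G_Y` for all `a ∈ A`, as on the
Cattani–Deligne–Kaplan locus of the Hodge tensors defining `G_Y`), then `Y` is an irreducible
component of `A`: a strictly larger irreducible closed `Y' ⊆ A` would have
`genericMTRank Y < genericMTRank Y' ≤ genericMTRank A ≤ genericMTRank Y`. (Ranks bounded, as for
every honest datum.) [cite: BaldiKlinglerUllmo2024, Lemma 3.6] -/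
theorem isIrredComponentOnPoints_of_isSpecialSubvariety [HodgeTensorFacts.{0, 0}] {S : SchemeOver ℂ}
    {w : ℤ} (D : VHSData (ComplexPoints S) w) [∀ s, Module.Finite ℚ (D.V.fiber s)]
    (hbdd : BddAbove (Set.range fun s : ComplexPoints S => D.mtRankAt s))
    {Y A : Set (ComplexPoints S)} (hY : D.IsSpecialSubvariety Y) (hYA : Y ⊆ A)
    (hr : D.genericMTRank A ≤ D.genericMTRank Y) : IsIrredComponentOnPoints S A Y := by
  refine ⟨hY.1, hYA, fun Y' hY' hYY' hY'A => ?_⟩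
  by_contra hne
  have hlt := hY.2 Y' hY' (hYY'.ssubset_of_ne (Ne.symm hne))
  have hle : D.genericMTRank Y' ≤ D.genericMTRank A :=
    genericMTRank_mono D hbdd hY'A (by
      obtain ⟨P, hP⟩ := hY'.2.nonempty
      exact ⟨P.val, hP⟩)
  omega

/-- **The stub from a RANK ENVELOPE (the exact Cattani–Deligne–Kaplan + André interface).** If the
pointwise Mumford–Tate ranks are bounded and there are countably many Zariski-closed sets of points
`A` such that every special `Y` meeting `U(ℂ)` lies in some `A` with `genericMTRank A ≤ genericMTRank Y`
— for the Gauss–Manin datum: `A` = the closure of the image in `S` of a connected component of the CDK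
locus (over the quasi-projective `U`) of a finite tensor tuple cutting out a `ℚ`-subgroup `G ≤ GL(V)`,
on which `MT(V_a) ⊆ G` (CDK 1995 Thm. 1.1 / Cor. 1.2; André 1992 §5; BKU 2024 §3.2–3.4), countably
many `(G, K, component)` — then the special subvarieties meeting the affine open `U` are countably
many (`isIrredComponentOnPoints_of_isSpecialSubvariety` + `countable_irredComponentsOnPoints_meeting_affineOpen`).
[cite: BaldiKlinglerUllmo2024, §3.4 and Lemma 3.6] [cite: CattaniDeligneKaplan1995JAMS, Thm. 1.1 and Cor. 1.2] -/
theorem countable_special_meeting_affineOpen_of_rankEnvelope [HodgeTensorFacts.{0, 0}]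
    {S : SchemeOver ℂ} {w : ℤ} (D : VHSData (ComplexPoints S) w) [∀ s, Module.Finite ℚ (D.V.fiber s)]
    (hsm : AlgebraicGeometry.Smooth S.hom) (U : S.left.Opens) (hU : IsAffineOpen U)
    (hbdd : BddAbove (Set.range fun s : ComplexPoints S => D.mtRankAt s))
    (henv : ∃ 𝒜 : Set (Set (ComplexPoints S)), 𝒜.Countable ∧ (∀ A ∈ 𝒜, IsZariskiClosedOnPoints S A) ∧
      ∀ Y : Set (ComplexPoints S), D.IsSpecialSubvariety Y → (∃ y ∈ Y, y.pt ∈ U) →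
        ∃ A ∈ 𝒜, Y ⊆ A ∧ D.genericMTRank A ≤ D.genericMTRank Y) :
    {Y : Set (ComplexPoints S) | D.IsSpecialSubvariety Y ∧ ∃ y ∈ Y, y.pt ∈ U}.Countable := by
  obtain ⟨𝒜, h𝒜c, h𝒜z, h𝒜⟩ := henv
  refine (countable_irredComponentsOnPoints_meeting_affineOpen hsm U hU h𝒜c h𝒜z).mono ?_
  rintro Y ⟨hY, hyU⟩
  obtain ⟨A, hA, hYA, hr⟩ := h𝒜 Y hY hyU
  exact ⟨⟨A, hA, isIrredComponentOnPoints_of_isSpecialSubvariety D hbdd hY hYA hr⟩, hyU⟩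

/-- **Registered form** (`--supports` sub-goal of stub (iv') of crux stmt-HodgeConjecture-11595): the
special subvarieties meeting an affine open are countably many as soon as the pointwise Mumford–Tate
ranks are bounded and a countable rank envelope exists — `countable_special_meeting_affineOpen_of_rankEnvelope`
in closed `∀`-form. [cite: BaldiKlinglerUllmo2024, §3.4 and Lemma 3.6] [cite: CattaniDeligneKaplan1995JAMS, Thm. 1.1 and Cor. 1.2] -/
theorem stub_countable_special_meeting_affineOpen_of_rankEnvelope : ∀ [HodgeTensorFacts.{0, 0}] ⦃S : SchemeOver ℂ⦄ ⦃w : ℤ⦄ (D : VHSData (ComplexPoints S) w) [∀ s, Module.Finite ℚ (D.V.fiber s)], AlgebraicGeometry.Smooth S.hom → ∀ (U : S.left.Opens), IsAffineOpen U → BddAbove (Set.range fun s : ComplexPoints S => D.mtRankAt s) → (∃ 𝒜 : Set (Set (ComplexPoints S)), 𝒜.Countable ∧ (∀ A ∈ 𝒜, IsZariskiClosedOnPoints S A) ∧ ∀ Y : Set (ComplexPoints S), D.IsSpecialSubvariety Y → (∃ y ∈ Y, y.pt ∈ U) → ∃ A ∈ 𝒜, Y ⊆ A ∧ D.genericMTRank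 A ≤ D.genericMTRank Y) → {Y : Set (ComplexPoints S) | D.IsSpecialSubvariety Y ∧ ∃ y ∈ Y, y.pt ∈ U}.Countable :=
  fun D _ hsm U hU hbdd henv => countable_special_meeting_affineOpen_of_rankEnvelope D hsm U hU hbdd henv

end Summit.HodgeConjecture.HodgeConjecture.Theorems

end
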